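import Summits.HodgeConjecture.HodgeConjecture.Theses.TropicalWeilObstruction

/-!
# Line `identity-transfer` — crux `TropicalWeilVanishing` of route `TropicalWeilObstruction`

Crux item `stmt-HodgeConjecture-18478`, decl
`Summit.HodgeConjecture.HodgeConjecture.Theses.TropicalWeilObstruction.TropicalWeilVanishing` (K1):
for every positive definite `8 × 8` real `Q` commuting with `J = weilJ 4` with algebraically
independent free entries (`IsWeilGeneric 4 Q`), every effective tropical `4`-cycle
`Z : TropicalTorusCycle 8 4 Q` has `weilFunctional Z = 0`.

## The lever: TRANSFER TO THE IDENTITY PERIOD (strategist line, alternative to `Lines/birth.lean`)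

A counterexample to K1 never stays where it is born.  (i) GENERIC SPREAD: the realisations of a
fixed COMBINATORIAL TYPE (the discrete data of a `TropicalTorusCycle`: weights, frames, facet
classes / permutations / shifts) over a period `Q'` are the solutions of a rational LINEAR system in
(vertices, reference facets, edge coefficients, `Q'`) inside the open set `{det T_σ > 0}`; so the set
of periods where the type realises is a relatively open subset of a RATIONAL LINEAR subspace `A_τ`
of the `16`-dimensional space `Sym_J = {D = Dᵀ, DJ = JD}`, and a Weil-generic point in it forces
`A_τ = Sym_J`.  (ii) ISOGENY TRANSPORT: the orbit `{g gᵀ : g ∈ GL₄(ℚ(i))}` of the identity period is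
dense in the Weil period domain, and the push-forward of an effective tropical cycle under an
integral `J`-linear isogeny `f = N g⁻¹ : X_{g Q' gᵀ} → X_{Q'}` is effective, multiplies `W` by
`det_ℂ(f)² ≠ 0`, and carries a whole realisation family to a realisation family of ONE type.  Hence
(`stub_transportToIdentity`, true unconditionally): if K1 fails anywhere, the STANDARD torus
`ℝ⁸/ℤ⁸` (`Q = 1`) carries an effective `4`-cycle `Z₀` with `W(Z₀) ≠ 0` whose type realises over a
full neighbourhood of `1` in `Sym_J`.  Consequently

  K1  ⟺  OBSTRUCTION AT THE IDENTITY: every effective tropical `4`-cycle `Z₀` on `ℝ⁸/ℤ⁸` with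
         `W(Z₀) ≠ 0` admits a linear functional `ℓ` on `8 × 8` matrices, non-zero on `Sym_J`,
         vanishing at every period `Q' ∈ Sym_J` where the type of `Z₀` realises
         (`A_τ ∩ Sym_J ⊊ Sym_J`: Kontsevich's dual certificate `Φ`, PER TYPE, at ONE rational point).

The bet is thereby pinned to a single maximally symmetric RATIONAL torus: realisations may be taken
rational, the deformation matrix is integral, `ℓ_τ` is a computable left-kernel vector, the symmetry
group `U₄(ℤ[i]) ⋉ (ℚ/ℤ)⁸` acts, and refutation (an unobstructed `W ≠ 0` seed at `Q = 1`) and proof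
(a uniform formula for `ℓ_τ`) live in the same finite arena.

* `stub_rung_flatObstructed` — THE RUNG (size M/L, provable): a FLAT cycle (all cells parallel to one
  rational `4`-plane `M`) with `W ≠ 0` is obstructed: its type forces `Q'·K ⊂ M_ℝ` for a rank-4
  lattice `K` of facet shifts, and the Hermitian `D` with `D M_ℝ ⊂ M_ℝ` (`M_ℝ` totally real since
  `η_M ≠ 0`) form a `10`-dimensional subspace of the `16`-dimensional `Sym_J`.  Instance: the landed
  `kuhnCycle` (`Theorems/TropicalWeilVanishing/Negative/FalseWithoutIsWeilGeneric.lean`, `W = 1`)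
  has `A_τ ∩ Sym_J = {B = 0}`.
* `stub_transportToIdentity` — GENERIC SPREAD + ISOGENY TRANSPORT + PUSH-FORWARD (size L/XL, true
  unconditionally; the archive's Lemma 9.7 / Prop. `transportn` for `n = 4`).
* `stub_nonflatObstructedAtIdentity` — THE BET, transferred (size XL): every NON-flat effective
  tropical `4`-cycle on `ℝ⁸/ℤ⁸` with `W ≠ 0` is obstructed in some Weil direction.

`TropicalWeilVanishing_of` is the real (sorry-free) composition: given a generic `Q` and `Z` with
`W(Z) ≠ 0`, transport gives `Z₀` at `1` realising on an open `O ∋ 1`; the rung (flat case) or the bet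
(non-flat case) gives `ℓ` with `ℓ(D) ≠ 0` for some `D ∈ Sym_J`; but `1 + εD ∈ O ∩ Sym_J` for small
`ε ≠ 0` and `1 ∈ O ∩ Sym_J` are both realisable, so `ℓ(1 + εD) = ℓ(1) = 0`, `ε ℓ(D) = 0` — absurd.

No stub alone gives the crux (the rung and the bet speak about `Q = 1` only, which is NOT
Weil-generic — `not_isWeilGeneric_one`; transport PRODUCES cycles), nor `HodgeConjecture` /
`¬ HodgeConjecture`.  Disproof used: the landed Negative lemma
`tropicalWeilVanishing_false_without_isWeilGeneric` (any proof must use `IsWeilGeneric`): genericity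
is consumed exactly once, in `stub_transportToIdentity` (`A_τ = Sym_J` at a generic point); its
witness `kuhnCycle` is the model instance of the rung.  Dead lines: none recorded on this crux.
-/

namespace Summit.HodgeConjecture.HodgeConjecture.Cruxes.TropicalWeilVanishing.IdentityTransfer

open Summit.HodgeConjecture.HodgeConjecture.Theses.TropicalWeilObstruction
open scoped Topology

noncomputable section

/-- **Same combinatorial type.** Two effective tropical `p`-cycles (over possibly different period
matrices) have the same type when their DISCRETE data agree: number of cells and of facet classes,
and cell by cell the weight, the frame, and the facet class / permutation / lattice shift of every
facet slot (the real data — vertices, edge coefficients, reference facets — may differ).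
[cite: MikhalkinZharkov2014Eigenwave, Def. 4.2] [cite: Zharkov2020TropicalWeil, §2 (pp. 2–4)] -/
def SameType {g p : ℕ} {Q Q' : Matrix (Fin g) (Fin g) ℝ}
    (Z : Literature.AlgebraicGeometry.Tropical.TropicalTorusCycle g p Q)
    (Z' : Literature.AlgebraicGeometry.Tropical.TropicalTorusCycle g p Q') : Prop :=
  ∃ (hc : Z'.numCells = Z.numCells) (hf : Z'.numFacetClasses = Z.numFacetClasses),
    ∀ σ : Fin Z'.numCells,
      (Z'.cell σ).weight = (Z.cell (Fin.cast hc σ)).weight ∧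
      (Z'.cell σ).frame = (Z.cell (Fin.cast hc σ)).frame ∧
      ∀ i : Fin (p + 1),
        Fin.cast hf (Z'.facetClass σ i) = Z.facetClass (Fin.cast hc σ) i ∧
        Z'.facetPerm σ i = Z.facetPerm (Fin.cast hc σ) i ∧
        Z'.facetShift σ i = Z.facetShift (Fin.cast hc σ) i

/-- Every cycle has the type of itself. -/
theorem SameType.refl {g p : ℕ} {Q : Matrix (Fin g) (Fin g) ℝ}
    (Z : Literature.AlgebraicGeometry.Tropical.TropicalTorusCycle g p Q) : SameType Z Z :=
  ⟨rfl, rfl, fun σ => ⟨rfl, rfl, fun i => ⟨rfl, rfl, rfl⟩⟩⟩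

/-- **Flat cycles**: every frame column of every cell lies in the real column span of the frame of
every other cell (all cells are parallel to one rational `p`-plane; e.g. a triangulated subtorus).
[cite: MikhalkinZharkov2014Eigenwave, Def. 4.2] -/
def IsFlat {g p : ℕ} {Q : Matrix (Fin g) (Fin g) ℝ}
    (Z : Literature.AlgebraicGeometry.Tropical.TropicalTorusCycle g p Q) : Prop :=
  ∀ σ σ' : Fin Z.numCells, ∀ m : Fin p, ∃ c : Fin p → ℝ,
    ∀ a : Fin g, ((Z.cell σ).frame a m : ℝ) = ∑ m' : Fin p, ((Z.cell σ').frame a m' : ℝ) * c m'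

/-- **Obstructed at the identity** (Kontsevich's per-type dual certificate at `Q = 1`): some linear
functional on `8 × 8` real matrices, NON-ZERO on the Weil direction space `Sym_J`, vanishes at every
symmetric `J`-commuting period where the combinatorial type of `Z₀` realises.
[cite: Zharkov2020TropicalWeil, §1–2 (pp. 2–4)] -/
def ObstructedAtIdentity
    (Z₀ : Literature.AlgebraicGeometry.Tropical.TropicalTorusCycle (2 * 4) 4
      (1 : Matrix (Fin (2 * 4)) (Fin (2 * 4)) ℝ)) : Prop :=
  ∃ ℓ : Matrix (Fin (2 * 4)) (Fin (2 * 4)) ℝ →ₗ[ℝ] ℝ,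
    (∃ D : Matrix (Fin (2 * 4)) (Fin (2 * 4)) ℝ, D.IsSymm ∧
      D * Literature.AlgebraicGeometry.Tropical.weilJ 4 = Literature.AlgebraicGeometry.Tropical.weilJ 4 * D ∧ ℓ D ≠ 0) ∧
    ∀ Q' : Matrix (Fin (2 * 4)) (Fin (2 * 4)) ℝ, Q'.IsSymm →
      Q' * Literature.AlgebraicGeometry.Tropical.weilJ 4 = Literature.AlgebraicGeometry.Tropical.weilJ 4 * Q' →
      (∃ Z' : Literature.AlgebraicGeometry.Tropical.TropicalTorusCycle (2 * 4) 4 Q', SameType Z₀ Z') → ℓ Q' = 0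

/-- **Stub 1 — the rung: flat cycles with `W ≠ 0` are obstructed at the identity.**  A flat
effective tropical `4`-cycle `Z₀` on `ℝ⁸/ℤ⁸` (all cells parallel to one rational `4`-plane `M`) with
`W(Z₀) ≠ 0` has `M_ℝ` totally real (`η_M ≠ 0`), its type forces `Q'·k ∈ M_ℝ` for the rank-`4`
lattice of facet-shift differences, and `{D ∈ Sym_J : D M_ℝ ⊆ M_ℝ}` is `10`-dimensional: take `ℓ`
vanishing on it and not on `Sym_J`.  Model instance: `kuhnCycle` (`A_τ ∩ Sym_J = {B = 0}`).
[cite: Zharkov2020TropicalWeil, §2 (pp. 2–4)] [cite: MikhalkinZharkov2014Eigenwave, Def. 4.2] -/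
theorem stub_rung_flatObstructed :
    ∀ Z₀ : Literature.AlgebraicGeometry.Tropical.TropicalTorusCycle (2 * 4) 4
        (1 : Matrix (Fin (2 * 4)) (Fin (2 * 4)) ℝ),
      Literature.AlgebraicGeometry.Tropical.weilFunctional Z₀ ≠ 0 → IsFlat Z₀ →
        ObstructedAtIdentity Z₀ := by
  sorry

/-- **Stub 2 — transport to the identity (generic spread + isogeny transport + push-forward).**
If some Weil-generic period carries an effective tropical `4`-cycle with `W ≠ 0`, then the standard
torus `ℝ⁸/ℤ⁸` carries one, `Z₀`, whose combinatorial type realises at every symmetric `J`-commuting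
period of an open neighbourhood of `1`.  (Realisation set of a type = relatively open subset of a
rational linear subspace `A_τ ⊆ Sym_J`; a generic point forces `A_τ = Sym_J`; `{g gᵀ : g ∈ GL₄(ℚ(i))}`
is dense in the Weil period domain; `f = N g⁻¹` pushes a realisation family over `g O gᵀ` forward to
a one-type realisation family over `O ∋ 1`, scaling `W` by `det_ℂ(f)² ≠ 0`.)
[cite: Zharkov2020TropicalWeil, §2 (pp. 2–4)] [cite: MikhalkinZharkov2014Eigenwave, Def. 4.2, Prop. 4.3] -/
theorem stub_transportToIdentity :
    (∃ Q : Matrix (Fin (2 * 4)) (Fin (2 * 4)) ℝ, Q.PosDef ∧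
        Q * Literature.AlgebraicGeometry.Tropical.weilJ 4 = Literature.AlgebraicGeometry.Tropical.weilJ 4 * Q ∧
        Literature.AlgebraicGeometry.Tropical.IsWeilGeneric 4 Q ∧
        ∃ Z : Literature.AlgebraicGeometry.Tropical.TropicalTorusCycle (2 * 4) 4 Q,
          Literature.AlgebraicGeometry.Tropical.weilFunctional Z ≠ 0) →
    ∃ Z₀ : Literature.AlgebraicGeometry.Tropical.TropicalTorusCycle (2 * 4) 4
        (1 : Matrix (Fin (2 * 4)) (Fin (2 * 4)) ℝ),
      Literature.AlgebraicGeometry.Tropical.weilFunctional Z₀ ≠ 0 ∧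
      ∃ O : Set (Matrix (Fin (2 * 4)) (Fin (2 * 4)) ℝ), IsOpen O ∧ (1 : Matrix (Fin (2 * 4)) (Fin (2 * 4)) ℝ) ∈ O ∧
        ∀ Q' ∈ O, Q'.IsSymm →
          Q' * Literature.AlgebraicGeometry.Tropical.weilJ 4 = Literature.AlgebraicGeometry.Tropical.weilJ 4 * Q' →
          ∃ Z' : Literature.AlgebraicGeometry.Tropical.TropicalTorusCycle (2 * 4) 4 Q', SameType Z₀ Z' := by
  sorry

/-- **Stub 3 — the bet, transferred: non-flat cycles with `W ≠ 0` are obstructed at the identity.**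
Every effective tropical `4`-cycle on the standard torus `ℝ⁸/ℤ⁸` which is not flat and has
`W ≠ 0` admits a per-type dual certificate: a linear functional non-zero on `Sym_J` killing every
symmetric `J`-commuting period where its type realises (`A_τ ∩ Sym_J ⊊ Sym_J`).  With stubs 1–2 this is
EQUIVALENT to the crux; it is Kontsevich's count made local at one rational period.
[cite: Zharkov2020TropicalWeil, §1–2 (pp. 2–4)] -/
theorem stub_nonflatObstructedAtIdentity :
    ∀ Z₀ : Literature.AlgebraicGeometry.Tropical.TropicalTorusCycle (2 * 4) 4
        (1 : Matrix (Fin (2 * 4)) (Fin (2 * 4)) ℝ),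
      Literature.AlgebraicGeometry.Tropical.weilFunctional Z₀ ≠ 0 → ¬ IsFlat Z₀ →
        ObstructedAtIdentity Z₀ := by
  sorry

/-! ## Name-keyed aliases of the three statements — the hypotheses of `TropicalWeilVanishing_of`
(device of `Lines/birth.lean`: the skeleton audit admits a hypothesis of the skeleton theorem only if its head
constant is NAMED like a declared stub; `__Registered.stub_X` is the statement of `stub_X` verbatim). -/
namespace __Registered

/-- Statement of `stub_rung_flatObstructed`, keyed by the registered stub name. -/
abbrev stub_rung_flatObstructed : Prop :=
  ∀ Z₀ : Literature.AlgebraicGeometry.Tropical.TropicalTorusCycle (2 * 4) 4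
      (1 : Matrix (Fin (2 * 4)) (Fin (2 * 4)) ℝ),
    Literature.AlgebraicGeometry.Tropical.weilFunctional Z₀ ≠ 0 → IsFlat Z₀ → ObstructedAtIdentity Z₀

/-- Statement of `stub_transportToIdentity`, keyed by the registered stub name. -/
abbrev stub_transportToIdentity : Prop :=
  (∃ Q : Matrix (Fin (2 * 4)) (Fin (2 * 4)) ℝ, Q.PosDef ∧
      Q * Literature.AlgebraicGeometry.Tropical.weilJ 4 = Literature.AlgebraicGeometry.Tropical.weilJ 4 * Q ∧
      Literature.AlgebraicGeometry.Tropical.IsWeilGeneric 4 Q ∧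
      ∃ Z : Literature.AlgebraicGeometry.Tropical.TropicalTorusCycle (2 * 4) 4 Q,
        Literature.AlgebraicGeometry.Tropical.weilFunctional Z ≠ 0) →
  ∃ Z₀ : Literature.AlgebraicGeometry.Tropical.TropicalTorusCycle (2 * 4) 4
      (1 : Matrix (Fin (2 * 4)) (Fin (2 * 4)) ℝ),
    Literature.AlgebraicGeometry.Tropical.weilFunctional Z₀ ≠ 0 ∧
    ∃ O : Set (Matrix (Fin (2 * 4)) (Fin (2 * 4)) ℝ), IsOpen O ∧ (1 : Matrix (Fin (2 * 4)) (Fin (2 * 4)) ℝ) ∈ O ∧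
      ∀ Q' ∈ O, Q'.IsSymm →
        Q' * Literature.AlgebraicGeometry.Tropical.weilJ 4 = Literature.AlgebraicGeometry.Tropical.weilJ 4 * Q' →
        ∃ Z' : Literature.AlgebraicGeometry.Tropical.TropicalTorusCycle (2 * 4) 4 Q', SameType Z₀ Z'

/-- Statement of `stub_nonflatObstructedAtIdentity`, keyed by the registered stub name. -/
abbrev stub_nonflatObstructedAtIdentity : Prop :=
  ∀ Z₀ : Literature.AlgebraicGeometry.Tropical.TropicalTorusCycle (2 * 4) 4
      (1 : Matrix (Fin (2 * 4)) (Fin (2 * 4)) ℝ),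
    Literature.AlgebraicGeometry.Tropical.weilFunctional Z₀ ≠ 0 → ¬ IsFlat Z₀ → ObstructedAtIdentity Z₀

end __Registered

/-- **Composition (real proof) — THE SKELETON THEOREM.**  Given a generic Weil period `Q` and an
effective tropical `4`-cycle `Z`, suppose `W(Z) ≠ 0`.  Transport (stub 2) yields `Z₀` on `ℝ⁸/ℤ⁸`
with `W(Z₀) ≠ 0` whose type realises at every symmetric `J`-commuting period of an open `O ∋ 1`;
the rung (flat case, stub 1) or the bet (non-flat case, stub 3) yields `ℓ` non-zero at some
`D ∈ Sym_J` and vanishing at every realisable period of `Sym_J`; but `1` and `1 + ε D` (small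
`ε > 0`) are realisable, so `ε · ℓ D = ℓ (1 + ε D) - ℓ 1 = 0`, contradiction.  Hypotheses = the three
stub statements (name-keyed aliases); concludes the route decl `TropicalWeilVanishing` BY NAME. -/
theorem TropicalWeilVanishing_of :
    __Registered.stub_rung_flatObstructed → __Registered.stub_transportToIdentity →
      __Registered.stub_nonflatObstructedAtIdentity → TropicalWeilVanishing := by
  intro h₁ h₂ h₃ Q hQ hJ hgen Z
  by_contra hW
  obtain ⟨Z₀, hW₀, O, hO, h1O, hall⟩ := h₂ ⟨Q, hQ, hJ, hgen, Z, hW⟩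
  have hobs : ObstructedAtIdentity Z₀ := by
    by_cases hflat : IsFlat Z₀
    · exact h₁ Z₀ hW₀ hflat
    · exact h₃ Z₀ hW₀ hflat
  obtain ⟨ℓ, ⟨D, hDsymm, hDJ, hℓD⟩, hvan⟩ := hobs
  -- the identity period is realisable (by `Z₀` itself), hence `ℓ 1 = 0`
  have h1 : ℓ 1 = 0 :=
    hvan 1 Matrix.isSymm_one (by rw [Matrix.one_mul, Matrix.mul_one]) ⟨Z₀, SameType.refl Z₀⟩
  -- `1 + ε • D ∈ O` for all small `ε`
  have hcont : Continuous fun ε : ℝ => (1 : Matrix (Fin (2 * 4)) (Fin (2 * 4)) ℝ) + ε • D :=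
    continuous_const.add (continuous_id.smul continuous_const)
  have hev : ∀ᶠ ε in 𝓝 (0 : ℝ), (1 : Matrix (Fin (2 * 4)) (Fin (2 * 4)) ℝ) + ε • D ∈ O := by
    apply hcont.continuousAt.eventually_mem
    apply hO.mem_nhds
    simpa using h1O
  obtain ⟨δ, hδ, hball⟩ := Metric.eventually_nhds_iff.1 hev
  set ε : ℝ := δ / 2 with hε
  have hεpos : 0 < ε := by rw [hε]; linarith
  have hεO : (1 : Matrix (Fin (2 * 4)) (Fin (2 * 4)) ℝ) + ε • D ∈ O := by
    apply hball
    rw [Real.dist_eq, sub_zero, abs_of_pos hεpos, hε]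
    linarith
  -- `1 + ε • D` is a symmetric `J`-commuting period, realisable by `hall`, hence killed by `ℓ`
  have hsymm : ((1 : Matrix (Fin (2 * 4)) (Fin (2 * 4)) ℝ) + ε • D).IsSymm :=
    Matrix.isSymm_one.add (hDsymm.smul ε)
  have hcomm : ((1 : Matrix (Fin (2 * 4)) (Fin (2 * 4)) ℝ) + ε • D) * Literature.AlgebraicGeometry.Tropical.weilJ 4 =
      Literature.AlgebraicGeometry.Tropical.weilJ 4 * ((1 : Matrix (Fin (2 * 4)) (Fin (2 * 4)) ℝ) + ε • D) := by
    rw [Matrix.add_mul, Matrix.mul_add, Matrix.one_mul, Matrix.mul_one, Matrix.smul_mul, Matrix.mul_smul, hDJ]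
  have h2 : ℓ ((1 : Matrix (Fin (2 * 4)) (Fin (2 * 4)) ℝ) + ε • D) = 0 :=
    hvan _ hsymm hcomm (hall _ hεO hsymm hcomm)
  rw [map_add, map_smul, h1, zero_add, smul_eq_mul] at h2
  rcases mul_eq_zero.1 h2 with h | h
  · exact absurd h hεpos.ne'
  · exact hℓD h

/-- **The crux, closed modulo exactly the three registered stubs** (sanity: the stubs compose, and
each alias is its stub's statement). -/
theorem TropicalWeilVanishing_of_stubs : TropicalWeilVanishing :=
  TropicalWeilVanishing_of stub_rung_flatObstructed stub_transportToIdentity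
    stub_nonflatObstructedAtIdentity

end

end Summit.HodgeConjecture.HodgeConjecture.Cruxes.TropicalWeilVanishing.IdentityTransfer
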